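import Summits.AnomalousDissipation.AnomalousDissipation.Theorems.SolenoidalFractalHomogenisationLagrangianStepFrameConjugacyAssembly
import Summits.AnomalousDissipation.AnomalousDissipation.Theorems.SolenoidalFractalHomogenisationLagrangianStepFrameResidual
import Summits.AnomalousDissipation.AnomalousDissipation.Theorems.SolenoidalFractalHomogenisationLagrangianCarrierPushforward
import HarnessLib

/-!
# K1L_D (stmt-AnomalousDissipation-27980), `stub_Z7_alphaBeta` α-provider, (L1) of memo L13: SOLENOIDALITY THROUGH THE FRAME
# (helper; `--supports … --as helper`; lead-k1l-onelevel-p1 g5)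

`u ∈ V2` is weakly divergence free iff its frame reading `frameRead σ u = u ∘ X m t' s` (`t' = s + σ/a(m+1)`), distorted by the inverse Jacobian
`frameG E m t' s`, is weakly divergence free — the constraint of the distorted class `IsWeakTensorPassiveVectorDistortedOn`.  Both directions
are the landed pushforward lemma `LagrangianCarrier.isWeaklyDivFree_of_insertion` (change of variables under the volume-preserving flow +
duality of pushforward and gradient), once along `X m t' s` and once along the inverse flow `X m s t'`, GIVEN three pointwise facts about the frame
at time `t'` (hypotheses; on refresh windows they are `FrameEddy.isUnit_det_flowDeriv` / `LevelRegular.det_flowDeriv_eq_one`, the derivative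
group law of the flow, and `FrameForm.isSmooth_frameG_entry`):
(hU) `frameJac E m t' s y` is invertible; (hInv) `flowDeriv m t' s (X m s t' y) ∘ flowDeriv m s t' y = id` (derivative of `X m t' s ∘ X m s t' = id`);
(hGc) the entries of `frameG E m t' s` are continuous.
* `aestronglyMeasurable_distort` — `distort G f` is a.e.-strongly measurable for continuous `G` and a.e.-strongly measurable `f`;
* `frameG_comp_inv_eq` — under (hU)(hInv): `frameG E m t' s (X m s t' y) *ᵥ w = flowDeriv m s t' y w`;
* **`isWeaklyDivFree_distort_frameRead_iff`** — (L1).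
NOT a proof of the stub, of the crux, or of AD; rung F-D1.A0.
-/

set_option linter.dupNamespace false  -- the summit-side namespace `Summit.AnomalousDissipation.AnomalousDissipation.…` repeats a component by design (D-0017)

noncomputable section

namespace Summit.AnomalousDissipation.AnomalousDissipation.Theorems.SolenoidalFractalHomogenisation.LagrangianStep.FrameConj

open Literature.Analysis Literature.Analysis.FluidPDE Literature.Analysis.FunctionSpaces
open MeasureTheory Set Filter
open scoped InnerProductSpace
open Literature.Analysis.FluidPDE.LatticeShear (LagrangianLatticeCarrier)
open Summit.AnomalousDissipation.AnomalousDissipation.Theorems.SolenoidalFractalHomogenisation.LagrangianCarrier (isWeaklyDivFree_of_insertion)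

variable {k : ℕ}

/-! ## §1 Measurability of distorted fields -/

/-- `distort G f` is a.e.-strongly measurable for a matrix field with continuous entries and an a.e.-strongly measurable field. -/
theorem aestronglyMeasurable_distort {G : UnitAddTorus (Fin 3) → Matrix (Fin 3) (Fin 3) ℝ} (hG : ∀ c a, Continuous fun y => G y c a)
    {f : VF} (hf : AEStronglyMeasurable f volume) : AEStronglyMeasurable (Torus.distort G f) volume := by
  have hcoord : ∀ a, AEMeasurable (fun y => (WithLp.ofLp (f y)) a) volume := fun a =>
    ((PiLp.continuous_apply 2 (fun _ : Fin 3 => ℝ) a).measurable.comp_aemeasurable hf.aemeasurable)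
  have hpi : AEMeasurable (fun y => fun c => ∑ a, G y c a * (WithLp.ofLp (f y)) a) volume := by
    refine aemeasurable_pi_lambda _ fun c => ?_
    exact Finset.aemeasurable_sum (f := fun a y => G y c a * (WithLp.ofLp (f y)) a) Finset.univ
      fun a _ => ((hG c a).measurable.aemeasurable).mul (hcoord a)
  have h : Torus.distort G f = fun y => WithLp.toLp 2 (fun c => ∑ a, G y c a * (WithLp.ofLp (f y)) a) := by
    funext y
    ext c
    rw [Torus.distort_apply]
  rw [h]
  exact ((PiLp.continuous_toLp 2 (fun _ : Fin 3 => ℝ)).measurable.comp_aemeasurable hpi).aestronglyMeasurable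

/-! ## §2 The frame matrices under the group law -/

/-- `frameG` undoes `flowDeriv` pointwise when the Jacobian is invertible: `frameG y *ᵥ (flowDeriv y w) = w`. -/
theorem frameG_mulVec_flowDeriv (E : LagrangianLatticeCarrier k) (m : ℕ) (t w : ℝ) (y : UnitAddTorus (Fin 3))
    (hU : IsUnit (frameJac E m t w y)) (v : EuclideanSpace ℝ (Fin 3)) :
    (frameG E m t w y).mulVec (WithLp.ofLp (E.flowDeriv m t w y v)) = WithLp.ofLp v := by
  have h1 : WithLp.ofLp (E.flowDeriv m t w y v) = (frameJac E m t w y).mulVec (WithLp.ofLp v) := by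
    funext a; rw [frameJac_mulVec]
  have hdet : IsUnit (frameJac E m t w y).det := (Matrix.isUnit_iff_isUnit_det _).mp hU
  rw [h1, Matrix.mulVec_mulVec, frameG, Matrix.nonsing_inv_mul _ hdet, Matrix.one_mulVec]

/-- `flowDeriv` undoes `frameG` pointwise when the Jacobian is invertible: `flowDeriv y (frameG y *ᵥ w) = w`. -/
theorem flowDeriv_frameG_mulVec (E : LagrangianLatticeCarrier k) (m : ℕ) (t w : ℝ) (y : UnitAddTorus (Fin 3))
    (hU : IsUnit (frameJac E m t w y)) (v : EuclideanSpace ℝ (Fin 3)) :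
    E.flowDeriv m t w y (WithLp.toLp 2 ((frameG E m t w y).mulVec (WithLp.ofLp v))) = v := by
  have hdet : IsUnit (frameJac E m t w y).det := (Matrix.isUnit_iff_isUnit_det _).mp hU
  ext a
  rw [← frameJac_mulVec]
  rw [WithLp.ofLp_toLp, Matrix.mulVec_mulVec, frameG, Matrix.mul_nonsing_inv _ hdet, Matrix.one_mulVec]

/-- Under the derivative group law, the inverse Jacobian at the image point is the Jacobian of the inverse flow:
`frameG E m t' s (X m s t' y) *ᵥ w = flowDeriv m s t' y w`. -/
theorem frameG_comp_inv_eq (E : LagrangianLatticeCarrier k) (m : ℕ) (t' s : ℝ) (y : UnitAddTorus (Fin 3))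
    (hU : IsUnit (frameJac E m t' s (E.X m s t' y)))
    (hInv : ∀ w : EuclideanSpace ℝ (Fin 3), E.flowDeriv m t' s (E.X m s t' y) (E.flowDeriv m s t' y w) = w)
    (w : EuclideanSpace ℝ (Fin 3)) :
    WithLp.toLp 2 ((frameG E m t' s (E.X m s t' y)).mulVec (WithLp.ofLp w)) = E.flowDeriv m s t' y w := by
  have h := frameG_mulVec_flowDeriv E m t' s (E.X m s t' y) hU (E.flowDeriv m s t' y w)
  rw [hInv w] at h
  ext a
  rw [← h]

/-! ## §3 (L1) Solenoidality through the frame -/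

/-- **(L1) Solenoidality through the frame.**  See the module docstring. -/
theorem isWeaklyDivFree_distort_frameRead_iff (E : LagrangianLatticeCarrier k) (hR : E.LevelRegular) (m : ℕ) (s σ : ℝ)
    (hU : ∀ y, IsUnit (frameJac E m (s + σ / E.a (m + 1)) s y))
    (hInv : ∀ (y : UnitAddTorus (Fin 3)) (w : EuclideanSpace ℝ (Fin 3)),
      E.flowDeriv m (s + σ / E.a (m + 1)) s (E.X m s (s + σ / E.a (m + 1)) y) (E.flowDeriv m s (s + σ / E.a (m + 1)) y w) = w)
    (hGc : ∀ c a, Continuous fun y => frameG E m (s + σ / E.a (m + 1)) s y c a) (u : V2) :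
    Torus.IsWeaklyDivFree (Torus.distort (frameG E m (s + σ / E.a (m + 1)) s) (⇑(frameRead E hR m s σ u) : VF)) ↔
      Torus.IsWeaklyDivFree (⇑u : VF) := by
  set t' : ℝ := s + σ / E.a (m + 1) with ht'
  -- the honest frame field and its distortion
  set v : VF := Torus.distort (frameG E m t' s) (fun y => (u : VF) (E.X m t' s y)) with hv
  have hae : (⇑(frameRead E hR m s σ u) : VF) =ᵐ[volume] fun y => (u : VF) (E.X m t' s y) := frameRead_coeFn E hR m s σ u
  have hvae : Torus.distort (frameG E m t' s) (⇑(frameRead E hR m s σ u) : VF) =ᵐ[volume] v := by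
    filter_upwards [hae] with y hy
    simp only [hv, Torus.distort, hy]
  have hXX : ∀ y, E.X m t' s (E.X m s t' y) = y := fun y => by
    have h := congrFun (hR.X_comp_X m t' s t') y
    rw [Function.comp_apply, hR.X_self m t'] at h
    exact h
  constructor
  · -- frame ⇒ Eulerian: insert `v` along `X m t' s`
    intro hdiv
    have hvdiv : Torus.IsWeaklyDivFree v := hdiv.congr_ae hvae
    refine isWeaklyDivFree_of_insertion E m t' s (hR.isSmooth_disp m t' s) (hR.measurePreserving_X m t' s) hvdiv
      (Lp.aestronglyMeasurable u) fun y => ?_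
    -- `u (X y) = flowDeriv y (G y *ᵥ u (X y))`
    rw [hv, show Torus.distort (frameG E m t' s) (fun y => (u : VF) (E.X m t' s y)) y
        = WithLp.toLp 2 ((frameG E m t' s y).mulVec (WithLp.ofLp ((u : VF) (E.X m t' s y)))) from rfl,
      flowDeriv_frameG_mulVec E m t' s y (hU y)]
  · -- Eulerian ⇒ frame: insert `u` along the inverse flow `X m s t'`
    intro hudiv
    have hvm : AEStronglyMeasurable v volume :=
      aestronglyMeasurable_distort hGc ((Lp.aestronglyMeasurable u).comp_measurePreserving (hR.measurePreserving_X m t' s))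
    have hvdiv : Torus.IsWeaklyDivFree v := by
      refine isWeaklyDivFree_of_insertion E m s t' (hR.isSmooth_disp m s t') (hR.measurePreserving_X m s t') hudiv hvm fun y => ?_
      rw [hv, show Torus.distort (frameG E m t' s) (fun y => (u : VF) (E.X m t' s y)) (E.X m s t' y)
          = WithLp.toLp 2 ((frameG E m t' s (E.X m s t' y)).mulVec (WithLp.ofLp ((u : VF) (E.X m t' s (E.X m s t' y))))) from rfl,
        hXX, frameG_comp_inv_eq E m t' s y (hU _) (hInv y)]
    exact hvdiv.congr_ae hvae.symm

end Summit.AnomalousDissipation.AnomalousDissipation.Theorems.SolenoidalFractalHomogenisation.LagrangianStep.FrameConj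

end
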